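import Summits.ValiantsHypothesis.ValiantsHypothesis.Theorems.SymPencilPerFourToricZeroRow

/-!
# Route `SymPencil` — the toric case at dimension `6`: single-row spaces are bounded by the row
# rank (`--supports` stmt-ValiantsHypothesis-5674; crux workfile `Cruxes/SdcSuperquadratic/TORIC-SIX.md`)

`finrank_single_row_le`: the elements of `W` vanishing on three rows `a, b, c` form a space of
dimension at most the rank of the fourth row `p` (the row map is injective on them).  Companion of
`SymPencilPerFourToricLowRank.single_row_realize`.  Honest framing: linear algebra; nothing here
changes `sdc(per_4) ≥ 25`; the crux `SdcSuperquadratic` and `VP ≠ VNP` are untouched.  No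
definitions, no named facts. [folklore]
-/

noncomputable section

-- single-conjunct layout: Sub = Summit, duplicated namespace component intended
set_option linter.dupNamespace false

namespace Summit.ValiantsHypothesis.ValiantsHypothesis.Theorems.SymPencilPerFourToricSingleRow

open Matrix Finset Module
open Literature.Computability.AlgebraicComplexity.AlperBogartVelasco
open Summit.ValiantsHypothesis.ValiantsHypothesis.Theorems.SymPencilPerFourHessianRankThreeZero
open Summit.ValiantsHypothesis.ValiantsHypothesis.Theorems.SymPencilPerFourToricZeroRow

variable {K : Type*} [Field K]

/-- Single-row spaces are at most as large as the row image. [folklore] -/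
theorem finrank_single_row_le (W : Submodule K (Fin 4 × Fin 4 → K)) (p a b c : Fin 4)
    (hpa : p ≠ a) (hpb : p ≠ b) (hpc : p ≠ c) (hab : a ≠ b) (hac : a ≠ c) (hbc : b ≠ c) :
    finrank K ↥(W ⊓ LinearMap.ker (LinearMap.funLeft K K fun j : Fin 4 => (a, j)) ⊓
        LinearMap.ker (LinearMap.funLeft K K fun j : Fin 4 => (b, j)) ⊓
        LinearMap.ker (LinearMap.funLeft K K fun j : Fin 4 => (c, j))) ≤
      finrank K (W.map (LinearMap.funLeft K K fun j : Fin 4 => (p, j))) := by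
  set T := W ⊓ LinearMap.ker (LinearMap.funLeft K K fun j : Fin 4 => (a, j)) ⊓
        LinearMap.ker (LinearMap.funLeft K K fun j : Fin 4 => (b, j)) ⊓
        LinearMap.ker (LinearMap.funLeft K K fun j : Fin 4 => (c, j)) with hT
  have eρ : ∀ (r : Fin 4) (x : Fin 4 × Fin 4 → K) (j : Fin 4),
      (LinearMap.funLeft K K fun j : Fin 4 => (r, j)) x j = x (r, j) := fun _ _ _ => rfl
  have memT : ∀ z, z ∈ T → (∀ j, z (a, j) = 0) ∧ (∀ j, z (b, j) = 0) ∧ ∀ j, z (c, j) = 0 := by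
    intro z hz
    rw [hT, Submodule.mem_inf, mem_pair_iff, LinearMap.mem_ker] at hz
    exact ⟨hz.1.2.1, hz.1.2.2, fun j => congr_fun hz.2 j⟩
  have hinj : Function.Injective ((LinearMap.funLeft K K fun j : Fin 4 => (p, j)).domRestrict T) := by
    intro z₁ z₂ h
    apply Subtype.ext
    have hsub : ((z₁ : Fin 4 × Fin 4 → K) - z₂) ∈ T := T.sub_mem z₁.2 z₂.2
    obtain ⟨hza, hzb, hzc⟩ := memT _ hsub
    funext e; obtain ⟨i, j⟩ := e
    refine sub_eq_zero.1 ?_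
    rw [← Pi.sub_apply]
    rcases eq_or_of_four p a b c hpa hpb hpc hab hac hbc i with hi | hi | hi | hi <;> rw [hi]
    · have := congr_fun h j
      simp only [LinearMap.domRestrict_apply, eρ] at this
      rw [Pi.sub_apply, this, sub_self]
    · exact hza j
    · exact hzb j
    · exact hzc j
  have h := LinearMap.finrank_range_of_inj hinj
  rw [LinearMap.range_domRestrict] at h
  rw [← h]
  exact Submodule.finrank_mono (Submodule.map_mono (inf_le_left.trans (inf_le_left.trans inf_le_left)))


end Summit.ValiantsHypothesis.ValiantsHypothesis.Theorems.SymPencilPerFourToricSingleRow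

end
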